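import Summits.HubbardSuperconductivity.HubbardSuperconductivity.Theorems.AnisotropyChordInsertionEntropyCoulombSheetDeconfined
import Summits.HubbardSuperconductivity.HubbardSuperconductivity.Theorems.AnisotropyChordInsertionEntropyGroundStateFloor

/-!
# Route `AnisotropyChord` / H0 rotor rung: THE DIRECT ONSAGER ROUTE TO TELEPORTATION DECONFINEMENT — Jastrow states,
# TAME FACTORS (rung J⁺), and the Coulomb-sheet BEC floor with a LINEAR-in-β exponent
# (theory seat `hubbard-h0-rotor-theory-1`, cycle 9, memo ROTOR-THEORY-9 §136 (c)(d)(g); cycle 10 §139 (c))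

Part S showed that only the pair-mass-AVERAGED teleportation entropy `−T(ψ)` matters
(`condensateDensity_ge_exp_meanTeleLog`: `n₀/|V| ≥ ρ(1−ρ)·e^{T/2}`).  For a canonical Jastrow state the move identity
`a(σ^{u→v})²/a(σ)² = e^{Φ_u(σ) − Φ_v(σ) + W(u−v)}` makes the teleportation sum of ONE configuration an affine function
of `Σ_{occ} Φ_u`, so Onsager's energy floor (`JastrowEnergyFloor`, from `KernelPSDShift` by `jastrowEnergyFloor_of_psd`)
bounds it DETERMINISTICALLY, configuration by configuration:

* `teleSum_jAmp_ge` : `Σ_{u occ, v emp} log(a(σ^{u→v})²/a(σ)²) ≥ −|G|·N·E` on the support;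
* **`meanTeleLog_jAmp_ge_of_energyFloor`** : `T(ψ_{W,N}) ≥ −(|G|/(|G|−N))·E` — compare the tree's
  `meanTeleLog_jAmp_ge_of_psd` (`−resamplingConst B D`, doubly exponential in `D`, via the sup-pair KL route); no upper
  bound on `W`, no density window is needed;
* **RUNG J⁺ (tame factors), `meanTeleLog_tame_ge` / `condensateDensity_tame_ge`**: for `ψ = F·ψ_{W,N}` normalised, with
  `F > 0` on the sector, translation invariant, and of mean move log-cost `≥ −B` PER CONFIGURATION (an averaged — not
  sup — tameness), `T(ψ) ≥ −(B + (|G|/(|G|−N))·E)` and hence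
  `n₀/|G| ≥ (N/|G|)(1−N/|G|)·exp(−(B + |G|E/(|G|−N))/2)`: the Jastrow floor is pointwise in `σ`, so ANY reweighting
  `F²` survives it (memo §136 (c): «every Jensen/floor step survives» — here no Jensen step is needed at all);
* **`condensateDensity_coulombSheet_ge_exp`** : for the half-filled periodic Coulomb-sheet Jastrow state on `(ℤ/L)²`
  (`D = 50β`): `ρ_L(1−ρ_L)·e^{−50β·L²/(L²−⌊L²/2⌋)} … `, and on even tori **`e^{−50β}/4 ≤ n₀/|Λ|`** for every `β ≥ 0`
  — the cycle-9 headline `condensateDensity_coulombSheet_ge_even` with `resamplingConst (50β) (50β)` replaced by `100β`.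
-/

set_option linter.dupNamespace false

noncomputable section

open Finset
open Literature.Probability.LatticeModels

namespace Summit.HubbardSuperconductivity.HubbardSuperconductivity.Theorems.AnisotropyChord.InsertionEntropy

section DirectOnsager

variable {G : Type} [AddCommGroup G] [Fintype G] [DecidableEq G]

/-- On the support, the log move ratio of the canonical Jastrow state is `Φ_u − Φ_v + W(u−v)`. [folklore] -/
theorem log_jAmp_move (W : G → ℝ) (hWe : ∀ z, W (-z) = W z) (hW0 : W 0 = 0) (N : ℕ) (σ : G → Fin 2)
    (hσ : jAmp W N σ ≠ 0) (u v : G) (hu : σ u = 0) (hv : σ v = 1) :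
    Real.log (jAmp W N (σ ∘ Equiv.swap u v) ^ 2 / jAmp W N σ ^ 2) = jPot W u σ - jPot W v σ + W (u - v) := by
  have huv : u ≠ v := by intro h; rw [h, hv] at hu; exact one_ne_zero hu
  rw [jAmp_sq_move W hWe hW0 N σ u v huv hu hv, mul_div_cancel_left₀ _ (pow_ne_zero 2 hσ), Real.log_exp]
  ring

/-- **Per-configuration teleportation sum of a Jastrow state (direct Onsager route).**  On the support of
`ψ_{W,N}` (`W` even, `W 0 = 0`, `W ≥ 0`), under the energy floor `JastrowEnergyFloor W N E`:
`Σ_{u occ, v emp} log(a(σ^{u→v})²/a(σ)²) ≥ −|G|·N·E`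
(`= (|G|−N)Σ_{occ}Φ − N Σ_{emp}Φ + Σ W ≥ |G|·Σ_{occ}Φ − N²S ≥ −|G| N E`). [folklore] -/
theorem teleSum_jAmp_ge (W : G → ℝ) (hWe : ∀ z, W (-z) = W z) (hW0 : W 0 = 0) (hWnn : ∀ z, 0 ≤ W z) (N : ℕ)
    {E : ℝ} (hEF : JastrowEnergyFloor W N E) (σ : G → Fin 2) (hσ : jAmp W N σ ≠ 0) :
    -((Fintype.card G : ℝ) * N * E)
      ≤ ∑ u, ∑ v, (if σ u = 0 ∧ σ v = 1 then
          Real.log (jAmp W N (σ ∘ Equiv.swap u v) ^ 2 / jAmp W N σ ^ 2) else 0) := by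
  have hpc : particleCount σ = N := jAmp_support W N σ hσ
  have hG : 0 < Fintype.card G := Fintype.card_pos_iff.mpr ⟨(0 : G)⟩
  have hV : (0 : ℝ) < (Fintype.card G : ℝ) := by exact_mod_cast hG
  -- replace the log by the potential difference, dropping `W(u−v) ≥ 0`
  have hterm : ∀ u v, occ σ u * (1 - occ σ v) * (jPot W u σ - jPot W v σ)
      ≤ (if σ u = 0 ∧ σ v = 1 then Real.log (jAmp W N (σ ∘ Equiv.swap u v) ^ 2 / jAmp W N σ ^ 2) else 0) := by
    intro u v
    by_cases h : σ u = 0 ∧ σ v = 1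
    · rw [if_pos h, log_jAmp_move W hWe hW0 N σ hσ u v h.1 h.2]
      have hocc : occ σ u * (1 - occ σ v) = 1 := by unfold occ; simp [h.1, h.2]
      rw [hocc, one_mul]
      linarith [hWnn (u - v)]
    · rw [if_neg h, ← ite_occ_emp_eq σ u v (jPot W u σ - jPot W v σ), if_neg h]
  have hsum_le : ∑ u, ∑ v, occ σ u * (1 - occ σ v) * (jPot W u σ - jPot W v σ)
      ≤ ∑ u, ∑ v, (if σ u = 0 ∧ σ v = 1 then
          Real.log (jAmp W N (σ ∘ Equiv.swap u v) ^ 2 / jAmp W N σ ^ 2) else 0) :=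
    Finset.sum_le_sum fun u _ => Finset.sum_le_sum fun v _ => hterm u v
  refine le_trans ?_ hsum_le
  -- evaluate the left-hand side
  set A : ℝ := ∑ u, occ σ u * jPot W u σ with hA
  have hoccN : ∑ u, occ σ u = (N : ℝ) := sum_occ_jAmp W N σ hσ
  have hemp : ∑ v, (1 - occ σ v) = (Fintype.card G : ℝ) - N := sum_one_sub_occ_jAmp W N σ hσ
  have hpotall : ∑ v, jPot W v σ = (N : ℝ) * kernelMass W := by rw [sum_jPot, hpc]
  have hempPot : ∑ v, (1 - occ σ v) * jPot W v σ = (N : ℝ) * kernelMass W - A := by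
    have : ∀ v, (1 - occ σ v) * jPot W v σ = jPot W v σ - occ σ v * jPot W v σ := fun v => by ring
    rw [Finset.sum_congr rfl fun v _ => this v, Finset.sum_sub_distrib, hpotall, hA]
  have hlhs : ∑ u, ∑ v, occ σ u * (1 - occ σ v) * (jPot W u σ - jPot W v σ)
      = ((Fintype.card G : ℝ) - N) * A - (N : ℝ) * ((N : ℝ) * kernelMass W - A) := by
    have hsplit : ∀ u, ∑ v, occ σ u * (1 - occ σ v) * (jPot W u σ - jPot W v σ)
        = occ σ u * jPot W u σ * ∑ v, (1 - occ σ v) - occ σ u * ∑ v, (1 - occ σ v) * jPot W v σ := by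
      intro u
      rw [Finset.mul_sum, Finset.mul_sum, ← Finset.sum_sub_distrib]
      exact Finset.sum_congr rfl fun v _ => by ring
    rw [Finset.sum_congr rfl fun u _ => hsplit u, Finset.sum_sub_distrib, hemp, hempPot, ← Finset.sum_mul,
      ← Finset.sum_mul, hoccN, hA]
    ring
  rw [hlhs]
  -- energy floor: N (c − E) ≤ A with |G| c = N S
  have hfl : (N : ℝ) * (jMeanPot W N - E) ≤ A := hEF σ hpc
  have hc : (Fintype.card G : ℝ) * jMeanPot W N = (N : ℝ) * kernelMass W := by
    unfold jMeanPot; field_simp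
  nlinarith [hfl, hc, hV]

/-- **`T(ψ_{W,N}) ≥ −(|G|/(|G|−N))·E` (direct Onsager route, PROVED).**  For an even kernel `W ≥ 0` with `W 0 = 0`,
`0 < N < |G|`, and the energy floor `JastrowEnergyFloor W N E`, the mean teleportation log-ratio of the canonical Jastrow
state is at least `−|G|E/(|G|−N)` — LINEAR in the floor constant (the tree's sup-pair route gives `−resamplingConst B E`).
[folklore] -/
theorem meanTeleLog_jAmp_ge_of_energyFloor (W : G → ℝ) (hWe : ∀ z, W (-z) = W z) (hW0 : W 0 = 0)
    (hWnn : ∀ z, 0 ≤ W z) (N : ℕ) (hN0 : 0 < N) (hNV : N < Fintype.card G) {E : ℝ}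
    (hEF : JastrowEnergyFloor W N E) :
    -((Fintype.card G : ℝ) / ((Fintype.card G : ℝ) - N) * E) ≤ meanTeleLog (jAmp W N) N := by
  have hZ := jastrowSectorWeight_jAmp_pos W N hNV.le
  have h1 : ∑ σ, jAmp W N σ ^ 2 = 1 := sum_jastrowSectorAmp_sq _ _ hZ
  have hN : (0 : ℝ) < (N : ℝ) := by exact_mod_cast hN0
  have hVN : (0 : ℝ) < (Fintype.card G : ℝ) - N := by
    have : (N : ℝ) < (Fintype.card G : ℝ) := by exact_mod_cast hNV
    linarith
  unfold meanTeleLog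
  rw [le_div_iff₀ (mul_pos hN hVN)]
  have hterm : ∀ σ, jAmp W N σ ^ 2 * (-((Fintype.card G : ℝ) * N * E))
      ≤ jAmp W N σ ^ 2 * ∑ u, ∑ v, (if σ u = 0 ∧ σ v = 1 then
          Real.log (jAmp W N (σ ∘ Equiv.swap u v) ^ 2 / jAmp W N σ ^ 2) else 0) := by
    intro σ
    by_cases hσ : jAmp W N σ = 0
    · rw [hσ]; simp
    · exact mul_le_mul_of_nonneg_left (teleSum_jAmp_ge W hWe hW0 hWnn N hEF σ hσ) (sq_nonneg _)
  have hsum := Finset.sum_le_sum fun σ (_ : σ ∈ Finset.univ) => hterm σ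
  rw [← Finset.sum_mul, h1, one_mul] at hsum
  refine le_trans (le_of_eq ?_) hsum
  field_simp

/-- **`T ≥ −(|G|/(|G|−N))·D` from `KernelPSDShift W D` alone** (Onsager's lemma `jastrowEnergyFloor_of_psd`). [folklore] -/
theorem meanTeleLog_jAmp_ge_of_psd_linear (W : G → ℝ) (hWe : ∀ z, W (-z) = W z) (hW0 : W 0 = 0)
    (hWnn : ∀ z, 0 ≤ W z) (N : ℕ) (hN0 : 0 < N) (hNV : N < Fintype.card G) {D : ℝ} (hD : 0 ≤ D)
    (hPSD : KernelPSDShift W D) :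
    -((Fintype.card G : ℝ) / ((Fintype.card G : ℝ) - N) * D) ≤ meanTeleLog (jAmp W N) N :=
  meanTeleLog_jAmp_ge_of_energyFloor W hWe hW0 hWnn N hN0 hNV
    (jastrowEnergyFloor_of_psd W hWe N D hD (by omega) hPSD)

/-! ### Rung J⁺ — tame factors -/

/-- Adding a particle increases the particle count by one. [folklore] -/
theorem particleCount_update_zero {V : Type} [Fintype V] [DecidableEq V] (τ : V → Fin 2) (x : V)
    (hx : τ x = 1) : particleCount (Function.update τ x 0) = particleCount τ + 1 := by
  unfold particleCount
  have h : (univ.filter fun z => Function.update τ x 0 z = 0) = insert x (univ.filter fun z => τ z = 0) := by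
    ext z
    simp only [Finset.mem_filter, Finset.mem_univ, true_and, Finset.mem_insert]
    by_cases hz : z = x
    · subst hz; simp
    · rw [Function.update_of_ne hz]; simp [hz]
  rw [h, Finset.card_insert_of_notMem]
  simp [hx]

/-- **RUNG J⁺ in the teleportation currency (PROVED): tame factors.**  Let `ψ σ = F σ · ψ_{W,N} σ` be normalised
(`Σ ψ² = 1`), with `F > 0` on the `N`-sector and MEAN move log-cost at least `−B` on every `N`-configuration:
`Σ_{u occ, v emp} log(F(σ^{u→v})²/F(σ)²) ≥ −B·N(|G|−N)`.  Then `T(ψ) ≥ −(B + |G|E/(|G|−N))` under the energy floor —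
the Jastrow part of the bound is pointwise in `σ`, so the reweighting by `F²` costs nothing.  Theory seat memo
ROTOR-THEORY-9 §136 (c) (J⁺, here with averaged instead of sup tameness). [folklore] -/
theorem meanTeleLog_tame_ge (W : G → ℝ) (hWe : ∀ z, W (-z) = W z) (hW0 : W 0 = 0) (hWnn : ∀ z, 0 ≤ W z)
    (N : ℕ) (hN0 : 0 < N) (hNV : N < Fintype.card G) {E : ℝ} (hEF : JastrowEnergyFloor W N E)
    (F : (G → Fin 2) → ℝ) (hFpos : ∀ σ, particleCount σ = N → 0 < F σ) {B : ℝ}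
    (hFtame : ∀ σ, particleCount σ = N →
      -(B * ((N : ℝ) * ((Fintype.card G : ℝ) - N)))
        ≤ ∑ u, ∑ v, (if σ u = 0 ∧ σ v = 1 then Real.log (F (σ ∘ Equiv.swap u v) ^ 2 / F σ ^ 2) else 0))
    (h1 : ∑ σ, (F σ * jAmp W N σ) ^ 2 = 1) :
    -(B + (Fintype.card G : ℝ) / ((Fintype.card G : ℝ) - N) * E)
      ≤ meanTeleLog (fun σ => F σ * jAmp W N σ) N := by
  have hN : (0 : ℝ) < (N : ℝ) := by exact_mod_cast hN0
  have hVN : (0 : ℝ) < (Fintype.card G : ℝ) - N := by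
    have : (N : ℝ) < (Fintype.card G : ℝ) := by exact_mod_cast hNV
    linarith
  -- per configuration: the log ratio splits into the F-part and the Jastrow part
  have hsplit : ∀ σ, jAmp W N σ ≠ 0 → ∀ u v, σ u = 0 → σ v = 1 →
      Real.log ((F (σ ∘ Equiv.swap u v) * jAmp W N (σ ∘ Equiv.swap u v)) ^ 2 / (F σ * jAmp W N σ) ^ 2)
        = Real.log (F (σ ∘ Equiv.swap u v) ^ 2 / F σ ^ 2)
          + Real.log (jAmp W N (σ ∘ Equiv.swap u v) ^ 2 / jAmp W N σ ^ 2) := by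
    intro σ hσ u v hu hv
    have hpc : particleCount σ = N := jAmp_support W N σ hσ
    have hpc' : particleCount (σ ∘ Equiv.swap u v) = N := by rw [particleCount_comp_equiv]; exact hpc
    have hF := hFpos σ hpc
    have hF' := hFpos _ hpc'
    have ha : 0 < jAmp W N σ := lt_of_le_of_ne (jastrowSectorAmp_nonneg _ _ _) (Ne.symm hσ)
    have ha' : 0 < jAmp W N (σ ∘ Equiv.swap u v) := jAmp_pos_comp_swap W N σ u v ha
    rw [← Real.log_mul (by positivity) (by positivity)]
    congr 1
    field_simp
  have hconf : ∀ σ, jAmp W N σ ≠ 0 →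
      -(B * ((N : ℝ) * ((Fintype.card G : ℝ) - N))) + -((Fintype.card G : ℝ) * N * E)
        ≤ ∑ u, ∑ v, (if σ u = 0 ∧ σ v = 1 then
            Real.log ((F (σ ∘ Equiv.swap u v) * jAmp W N (σ ∘ Equiv.swap u v)) ^ 2
              / (F σ * jAmp W N σ) ^ 2) else 0) := by
    intro σ hσ
    have hpc : particleCount σ = N := jAmp_support W N σ hσ
    have hrw : ∀ u v, (if σ u = 0 ∧ σ v = 1 then
        Real.log ((F (σ ∘ Equiv.swap u v) * jAmp W N (σ ∘ Equiv.swap u v)) ^ 2 / (F σ * jAmp W N σ) ^ 2) else 0)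
        = (if σ u = 0 ∧ σ v = 1 then Real.log (F (σ ∘ Equiv.swap u v) ^ 2 / F σ ^ 2) else 0)
          + (if σ u = 0 ∧ σ v = 1 then Real.log (jAmp W N (σ ∘ Equiv.swap u v) ^ 2 / jAmp W N σ ^ 2) else 0) := by
      intro u v
      by_cases h : σ u = 0 ∧ σ v = 1
      · rw [if_pos h, if_pos h, if_pos h, hsplit σ hσ u v h.1 h.2]
      · rw [if_neg h, if_neg h, if_neg h, add_zero]
    simp_rw [hrw, Finset.sum_add_distrib]
    exact add_le_add (hFtame σ hpc) (teleSum_jAmp_ge W hWe hW0 hWnn N hEF σ hσ)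
  unfold meanTeleLog
  rw [le_div_iff₀ (mul_pos hN hVN)]
  have hterm : ∀ σ, (F σ * jAmp W N σ) ^ 2 *
      (-(B * ((N : ℝ) * ((Fintype.card G : ℝ) - N))) + -((Fintype.card G : ℝ) * N * E))
      ≤ (F σ * jAmp W N σ) ^ 2 * ∑ u, ∑ v, (if σ u = 0 ∧ σ v = 1 then
          Real.log ((F (σ ∘ Equiv.swap u v) * jAmp W N (σ ∘ Equiv.swap u v)) ^ 2
            / (F σ * jAmp W N σ) ^ 2) else 0) := by
    intro σ
    by_cases hσ : jAmp W N σ = 0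
    · rw [hσ]; simp
    · exact mul_le_mul_of_nonneg_left (hconf σ hσ) (sq_nonneg _)
  have hsum := Finset.sum_le_sum fun σ (_ : σ ∈ Finset.univ) => hterm σ
  rw [← Finset.sum_mul, h1, one_mul] at hsum
  refine le_trans (le_of_eq ?_) hsum
  field_simp
  ring

/-- **RUNG J⁺ (BEC FOR TAME FACTORS, PROVED).**  Under the hypotheses of `meanTeleLog_tame_ge` plus translation
invariance of `F` (uniform density ⇒ symmetric pair masses):
`(N/|G|)(1−N/|G|)·exp(−(B + |G|E/(|G|−N))/2) ≤ condensateDensity (F·ψ_{W,N})` (Part S one-liner). [folklore] -/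
theorem condensateDensity_tame_ge (W : G → ℝ) (hWe : ∀ z, W (-z) = W z) (hW0 : W 0 = 0) (hWnn : ∀ z, 0 ≤ W z)
    (N : ℕ) (hN0 : 0 < N) (hNV : N < Fintype.card G) {E : ℝ} (hEF : JastrowEnergyFloor W N E)
    (F : (G → Fin 2) → ℝ) (hFpos : ∀ σ, particleCount σ = N → 0 < F σ)
    (hFtr : ∀ σ (t : G), F (σ ∘ Equiv.addRight t) = F σ) {B : ℝ}
    (hFtame : ∀ σ, particleCount σ = N →
      -(B * ((N : ℝ) * ((Fintype.card G : ℝ) - N)))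
        ≤ ∑ u, ∑ v, (if σ u = 0 ∧ σ v = 1 then Real.log (F (σ ∘ Equiv.swap u v) ^ 2 / F σ ^ 2) else 0))
    (h1 : ∑ σ, (F σ * jAmp W N σ) ^ 2 = 1) :
    ((N : ℝ) / Fintype.card G) * (1 - (N : ℝ) / Fintype.card G)
        * Real.exp (-(B + (Fintype.card G : ℝ) / ((Fintype.card G : ℝ) - N) * E) / 2)
      ≤ condensateDensity (fun σ => F σ * jAmp W N σ) := by
  set b : (G → Fin 2) → ℝ := fun σ => F σ * jAmp W N σ with hb
  have hZ := jastrowSectorWeight_jAmp_pos W N hNV.le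
  -- positivity of `b` on the whole sector, and non-negativity
  have hbpos : ∀ σ, particleCount σ = N → 0 < b σ := fun σ hσ =>
    mul_pos (hFpos σ hσ) (jastrowSectorAmp_pos _ N hZ σ hσ)
  have hbsupp : ∀ σ, b σ ≠ 0 → particleCount σ = N := by
    intro σ hσ
    have : jAmp W N σ ≠ 0 := fun h0 => hσ (by simp [hb, h0])
    exact jAmp_support W N σ this
  have hbnn : ∀ σ, 0 ≤ b σ := by
    intro σ
    by_cases hσ : particleCount σ = N
    · exact (hbpos σ hσ).le
    · have : jAmp W N σ = 0 := by
        by_contra h0; exact hσ (jAmp_support W N σ h0)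
      simp [hb, this]
  have hsect : ∀ σ, b σ ≠ 0 → ((univ.filter fun z => σ z = 0).card : ℝ) = (N : ℝ) := by
    intro σ hσ; exact_mod_cast hbsupp σ hσ
  -- translation invariance ⇒ uniform density ⇒ symmetric pair masses
  have hbtr : ∀ (t : G) σ, b (σ ∘ Equiv.addRight t) = b σ := by
    intro t σ; simp only [hb, hFtr σ t, jAmp_comp_addRight W N t σ]
  have hdens : ∀ x, siteDensity b x = siteDensity b 0 := by
    intro x
    have h := siteDensity_comp_equiv (Equiv.addRight x) b (hbtr x) 0
    have h0 : (Equiv.addRight x) (0 : G) = x := by simp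
    rw [h0] at h
    exact h
  have hsym : ∀ x y, pairMass b x y = pairMass b y x := pairMass_symm_of_siteDensity b _ hdens
  -- move closure and teleportation-support symmetry from positivity on the sector
  have hmove : ∀ σ (u v : G), u ≠ v → σ u = 0 → σ v = 1 → 0 < b σ → 0 < b (σ ∘ Equiv.swap u v) := by
    intro σ u v _ _ _ hσ
    have hpc := hbsupp σ hσ.ne'
    exact hbpos _ (by rw [particleCount_comp_equiv]; exact hpc)
  have hac : ∀ x y τ, x ≠ y → 0 < teleLaw b x y τ → 0 < teleLaw b y x τ := by
    intro x y τ _ h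
    unfold teleLaw at h ⊢
    by_cases hxy : τ x = 1 ∧ τ y = 1
    · rw [if_pos hxy] at h
      rw [if_pos ⟨hxy.2, hxy.1⟩]
      have hax : b (Function.update τ x 0) ≠ 0 := by
        intro h0; rw [h0] at h; simp at h
      have hpcx := hbsupp _ hax
      have hpcy : particleCount (Function.update τ y 0) = N := by
        rw [particleCount_update_zero τ y hxy.2, ← particleCount_update_zero τ x hxy.1]; exact hpcx
      have hby := hbpos _ hpcy
      exact div_pos (by positivity) (pairMass_pos_of_term b y x τ hxy.2 hxy.1 hby)
    · rw [if_neg hxy] at h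
      exact absurd h (lt_irrefl 0)
  have main := condensateDensity_ge_exp_meanTeleLog b N hbnn h1 hsect hsym hac hmove
  have hT := meanTeleLog_tame_ge W hWe hW0 hWnn N hN0 hNV hEF F hFpos hFtame h1
  refine le_trans ?_ main
  refine mul_le_mul_of_nonneg_left (Real.exp_le_exp.mpr (by linarith)) ?_
  have hV : (0 : ℝ) < (Fintype.card G : ℝ) := by
    exact_mod_cast Fintype.card_pos_iff.mpr ⟨(0 : G)⟩
  have hρ1 : (N : ℝ) / Fintype.card G ≤ 1 := by
    rw [div_le_one hV]; exact_mod_cast hNV.le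
  exact mul_nonneg (by positivity) (by linarith)

/-- **The Jastrow state itself (`F ≡ 1`) with the LINEAR constant:**
`(N/|G|)(1−N/|G|)·exp(−|G|D/(2(|G|−N))) ≤ condensateDensity ψ_{W,N}` from `KernelPSDShift W D` alone
(compare `condensateDensity_jAmp_ge_of_psd`, with `resamplingConst B D`). [folklore] -/
theorem condensateDensity_jAmp_ge_of_psd_linear (W : G → ℝ) (hWe : ∀ z, W (-z) = W z) (hW0 : W 0 = 0)
    (hWnn : ∀ z, 0 ≤ W z) (N : ℕ) (hN0 : 0 < N) (hNV : N < Fintype.card G) {D : ℝ} (hD : 0 ≤ D)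
    (hPSD : KernelPSDShift W D) :
    ((N : ℝ) / Fintype.card G) * (1 - (N : ℝ) / Fintype.card G)
        * Real.exp (-((Fintype.card G : ℝ) / ((Fintype.card G : ℝ) - N) * D) / 2)
      ≤ condensateDensity (jAmp W N) := by
  have hZ := jastrowSectorWeight_jAmp_pos W N hNV.le
  have h1 : ∑ σ, ((fun _ => (1 : ℝ)) σ * jAmp W N σ) ^ 2 = 1 := by
    simp only [one_mul]; exact sum_jastrowSectorAmp_sq _ _ hZ
  have h := condensateDensity_tame_ge W hWe hW0 hWnn N hN0 hNV (jastrowEnergyFloor_of_psd W hWe N D hD (by omega) hPSD)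
    (fun _ => 1) (fun _ _ => one_pos) (fun _ _ => rfl) (B := 0)
    (fun σ _ => by simp) h1
  simp only [one_mul, zero_add] at h
  exact h

end DirectOnsager

section CoulombSheetLinear

variable {L : ℕ} [NeZero L]

/-- **BEC OF THE HALF-FILLED COULOMB-SHEET JASTROW STATE WITH A LINEAR EXPONENT:** for every `β ≥ 0` and `L ≥ 2`,
`ρ_L(1−ρ_L)·exp(−(L²/(L² − ⌊L²/2⌋))·25β) ≤ condensateDensity (ψ_{W_L(β), ⌊L²/2⌋})`. [folklore] -/
theorem condensateDensity_coulombSheet_ge_exp {β : ℝ} (hβ : 0 ≤ β) (L : ℕ) [NeZero L] (hL : 2 ≤ L) :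
    ((L ^ 2 / 2 : ℕ) / (L : ℝ) ^ 2) * (1 - (L ^ 2 / 2 : ℕ) / (L : ℝ) ^ 2)
        * Real.exp (-(((L : ℝ) ^ 2 / ((L : ℝ) ^ 2 - (L ^ 2 / 2 : ℕ))) * (50 * β)) / 2)
      ≤ condensateDensity (jAmp (coulombSheetKernel L β) (L ^ 2 / 2)) := by
  obtain ⟨h1, h2, _⟩ := halfFilling_numerology L hL
  have hcard : (Fintype.card (TorusSite 2 L) : ℝ) = (L : ℝ) ^ 2 := by
    rw [Fintype.card_fun, ZMod.card, Fintype.card_fin]; push_cast; ring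
  have hcardN : Fintype.card (TorusSite 2 L) = L ^ 2 := by
    rw [Fintype.card_fun, ZMod.card, Fintype.card_fin]
  have hNV : L ^ 2 / 2 < Fintype.card (TorusSite 2 L) := by rw [hcardN]; omega
  have h := condensateDensity_jAmp_ge_of_psd_linear (coulombSheetKernel L β) (coulombSheetKernel_neg β)
    (coulombSheetKernel_zero β) (coulombSheetKernel_nonneg hβ) (L ^ 2 / 2) (by omega) hNV (by positivity)
    (coulombSheetKernel_psd hβ)
  rw [hcard] at h
  exact h

/-- **EVEN TORI: `e^{−50β}/4 ≤ n₀/|Λ|`** for the half-filled periodic Coulomb-sheet Jastrow/RK state at every coupling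
`β ≥ 0` — the cycle-9 headline `condensateDensity_coulombSheet_ge_even` with the doubly-exponential
`resamplingConst (50β) (50β)` replaced by the linear `100β`. [folklore] -/
theorem condensateDensity_coulombSheet_ge_exp_even {β : ℝ} (hβ : 0 ≤ β) (L : ℕ) [NeZero L] (hL : 2 ≤ L)
    (hev : Even L) :
    Real.exp (-(50 * β)) / 4 ≤ condensateDensity (jAmp (coulombSheetKernel L β) (L ^ 2 / 2)) := by
  have h := condensateDensity_coulombSheet_ge_exp hβ L hL
  obtain ⟨m, hm⟩ := hev
  have hm0 : 0 < m := by omega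
  have hLm : L ^ 2 / 2 = 2 * m ^ 2 := by
    rw [hm]; ring_nf; omega
  have hLr : (L : ℝ) = 2 * m := by rw [hm]; push_cast; ring
  rw [hLm] at h
  have hmr : (0 : ℝ) < (m : ℝ) := by exact_mod_cast hm0
  have hρ : ((2 * m ^ 2 : ℕ) : ℝ) / (L : ℝ) ^ 2 = 1 / 2 := by
    rw [hLr]; push_cast; field_simp
  have hfac : (L : ℝ) ^ 2 / ((L : ℝ) ^ 2 - ((2 * m ^ 2 : ℕ) : ℝ)) = 2 := by
    rw [hLr]; push_cast
    have : (2 * (m : ℝ)) ^ 2 - 2 * (m : ℝ) ^ 2 = 2 * (m : ℝ) ^ 2 := by ring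
    rw [this]; field_simp
  rw [hρ, hfac] at h
  have he : -(2 * (50 * β)) / 2 = -(50 * β) := by ring
  rw [he] at h
  have hq : (1 / 2 : ℝ) * (1 - 1 / 2) * Real.exp (-(50 * β)) = Real.exp (-(50 * β)) / 4 := by ring
  rw [hq] at h
  rw [hLm]
  exact h

end CoulombSheetLinear

end Summit.HubbardSuperconductivity.HubbardSuperconductivity.Theorems.AnisotropyChord.InsertionEntropy
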